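import Summits.Ventures.CertifiedManyBodySolver.Downfold.EmeryShapeWindowClosureBand
import Summits.Ventures.CertifiedManyBodySolver.Downfold.EmeryFermiScalePointsHg1201VirtualCorners
import HarnessLib

/-!
# THE ONE-BAND FERMI-SURFACE SHAPE `t′/t` OF THE WHOLE TYPED 3BE BOX `emeryBoxHg1201 (EmeryBoxesCuprates)` OVER ITS WHOLE FILLING BAND (two-ray rule + band window closure, §B.86 (k);
# router/EMERY-SHAPE-CORNERS.tsv «band» row)

Venture CertifiedManyBodySolver, cell `pub/hubbard-downfold` (stage S1; INFLATION-RULES-3to1-B §B.86 (k)), seat hubbard-downfold-mod-4 (technique B, g35); namespace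
`Summit.Ventures.CertifiedManyBodySolver.Downfold.Emery`. Everything PROVED (0 sorry). WHAT THIS IS NOT: a statement about HgBa₂CuO₄ (box #19, P = 0) — the typed box is SCREENING-GRADE;
`U = 0` one-body kinematics of the σ model (rigid band); object E = the EXACT `t–t′` shape of the σ Fermi surface.

**For EVERY one-body row of the box AND EVERY filling of the band n_H ∈ [1.125, 1.1600000000000001] (ν ∈ [21/50, 7/16]): n_H = 1.125 (ν = 7/16) … n_H = 1.16 (ν = 21/50), the one-band t′/t of the σ Fermi surface at that row's own Fermi energy lies in
[-0.3814, -0.2541]** (`hg1201Box_fsRatio_band`) — `fsRatio_fermiEnergyOf_mem_Icc_windowClosure_band` with the end-filling point brackets: lower window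
[ε_F(V_lo; ν₁)⁻, ε_F(A_lo; ν₂)⁺] = [1.5222, 1.682] (closure antitone), upper window [0, ε_F(V_hi; ν₂)⁺] = [0, 1.6241] (monotone), regime at ε_F(H; ν₂)⁺ = 2.044. The per-filling windows of
`EmeryBoxesHg1201ShapeCorners` are nested inside (same certificates).

Sources: three-band model [HybertsenSchluterChristensen1989, Eq. (1)]; [AndersenEtAl1995, §6]; box rows as cited in the typed object's file.
-/

noncomputable section

namespace Summit.Ventures.CertifiedManyBodySolver.Downfold.Emery

open Real Set

/-- **HgBa₂CuO₄ (box #19, P = 0), filling band n_H ∈ [1.125, 1.1600000000000001] (ν ∈ [21/50, 7/16]): n_H = 1.125 (ν = 7/16) … n_H = 1.16 (ν = 21/50): for every row of the box and every filling of the band, the one-band Fermi-surface `t′/t` (object E) lies in `[-0.3814, -0.2541]`.** [folklore] -/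
theorem hg1201Box_fsRatio_band {Δ a b c ν : ℝ} (hΔ : Δ ∈ Icc ((7 : ℝ) / 5) ((5 : ℝ) / 2)) (ha : a ∈ Icc ((28 : ℝ) / 25) ((33 : ℝ) / 25)) (hb : b ∈ Icc ((16 : ℝ) / 25) ((17 : ℝ) / 20)) (hc : c ∈ Icc ((161 : ℝ) / 1000) ((26 : ℝ) / 125)) (hν : ν ∈ Icc ((21 : ℝ) / 50) ((7 : ℝ) / 16)) :
    fsRatio Δ a b c (fermiEnergyOf Δ a b c ν) ∈ Icc ((-1907 : ℝ) / 5000) ((-2541 : ℝ) / 10000) := by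
  have hV : ((26 : ℝ) / 125) * ((17 : ℝ) / 20) / ((16 : ℝ) / 25) = ((221 : ℝ) / 800) := by norm_num
  have hW : ((161 : ℝ) / 1000) * ((16 : ℝ) / 25) / ((17 : ℝ) / 20) = ((1288 : ℝ) / 10625) := by norm_num
  have hVlo := (fermiEnergyOf_of_pointBracketCheck virtPt_Hg1201Vlo_nH116_br (by norm_num) (by norm_num) (by norm_num) (ν := (21/50 : ℝ)) (by push_cast; exact ⟨le_rfl, le_rfl⟩)).2
  have hVhi := (fermiEnergyOf_of_pointBracketCheck virtPt_Hg1201Vhi_nH1125_br (by norm_num) (by norm_num) (by norm_num) (ν := (7/16 : ℝ)) (by push_cast; exact ⟨le_rfl, le_rfl⟩)).2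
  have hAlo := (fermiEnergyOf_of_pointBracketCheck virtPt_Hg1201Alo_nH1125_br (by norm_num) (by norm_num) (by norm_num) (ν := (7/16 : ℝ)) (by push_cast; exact ⟨le_rfl, le_rfl⟩)).2
  have hTop := (fermiEnergyOf_of_pointBracketCheck virtPt_Hg1201H_nH1125_br (by norm_num) (by norm_num) (by norm_num) (ν := (7/16 : ℝ)) (by push_cast; exact ⟨le_rfl, le_rfl⟩)).2
  have hLo2 := (fermiEnergyOf_of_pointBracketCheck virtPt_Hg1201Vlo_nH116_br (by norm_num) (by norm_num) (by norm_num) (ν := (21/50 : ℝ)) (by push_cast; exact ⟨le_rfl, le_rfl⟩)).2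
  push_cast at hVlo hVhi hAlo hTop
  norm_num at hVlo hVhi hAlo hTop
  refine fsRatio_fermiEnergyOf_mem_Icc_windowClosure_band (Δ₁ := ((7 : ℝ) / 5)) (Δ₂ := ((5 : ℝ) / 2)) (a₁ := ((28 : ℝ) / 25)) (a₂ := ((33 : ℝ) / 25)) (b₁ := ((16 : ℝ) / 25))
    (b₂ := ((17 : ℝ) / 20)) (c₁ := ((161 : ℝ) / 1000)) (c₂ := ((26 : ℝ) / 125)) (e₁ := ((7611 : ℝ) / 5000)) (e₂ := ((841 : ℝ) / 500)) (e₃ := 0) (e₄ := ((16241 : ℝ) / 10000)) (ν₁ := ((21 : ℝ) / 50)) (ν₂ := ((7 : ℝ) / 16)) (by norm_num) (by norm_num) (by norm_num) (by norm_num)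
    (by norm_num) hΔ ha hb hc (by norm_num) hν (by norm_num) ?_ ?_ ?_ (by norm_num) ?_ ?_ ?_ (by norm_num) ?_
  · nlinarith [hTop.2]
  · rw [hV]; exact hVlo.1
  · exact hAlo.2
  · intro ε hε
    rw [hV]
    have hanti := (fsRatio_mem_Icc_on_window_of_dopingDisc_nonneg (Δ := ((7 : ℝ) / 5)) (a := ((28 : ℝ) / 25)) (b := ((17 : ℝ) / 20)) (c := ((221 : ℝ) / 800))
      (p := ((7611 : ℝ) / 5000)) (q := ((841 : ℝ) / 500)) (by norm_num) (by norm_num) (by norm_num) (by norm_num) (by norm_num) (by norm_num) (by norm_num)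
      (by norm_num [dopingDisc]) hε).1
    refine le_trans ?_ hanti
    norm_num [fsRatio, fsD, fsN]
  · exact (fermiEnergyOf_pos (by norm_num) (by norm_num) (by norm_num) (by norm_num) (by norm_num) (by norm_num)).le
  · rw [hW]; exact hVhi.2
  · intro ε hε
    rw [hW]
    have hmono := (fsRatio_mem_Icc_on_window_of_dopingDisc_nonpos (Δ := ((5 : ℝ) / 2)) (a := ((33 : ℝ) / 25)) (b := ((16 : ℝ) / 25)) (c := ((1288 : ℝ) / 10625))
      (p := 0) (q := ((16241 : ℝ) / 10000)) (by norm_num) (by norm_num) (by norm_num) (by norm_num) (by norm_num) (by norm_num) (by norm_num)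
      (by norm_num [dopingDisc]) hε).2
    refine le_trans hmono ?_
    norm_num [fsRatio, fsD, fsN]

end Summit.Ventures.CertifiedManyBodySolver.Downfold.Emery
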